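import Literature.AlgebraicGeometry.Resolution.ArithmeticalThreefoldsDescentHeadFrame
import Literature.AlgebraicGeometry.Resolution.ArithmeticalThreefoldsShapeOfDenominators
import Literature.AlgebraicGeometry.Resolution.ArithmeticalThreefoldsFiniteDenominators
import Literature.AlgebraicGeometry.Resolution.LocAtCentreDenominators
import Literature.AlgebraicGeometry.Resolution.Prop81MiddleAssemblyWithinF
import HarnessLib

/-!
# Cossart–Piltant 2019, Prop. 4.8: running Lemma 4.7 along `v̂` and concluding (LU) for `A`

Topic: `Literature/AlgebraicGeometry/Resolution` (proofs only; no new notions, no new named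
facts). This file assembles, for Cossart–Piltant's descent from the formal completion
(J. Algebra 529 (2019) = arXiv:1412.0868, proof of Prop. 4.8 with Lemma 4.7 and (510)–(512),
arXiv v1 Prop. 4.6 pp. 52–53), the part of the geometric head that comes AFTER the model and its
pre-stage: from a regular frame base `S₀` (an `Â`-algebra inside the formal branch `K̂₁`, in the
source a local ring of the model `Ŷ` or of its principalized blow-up) carrying the principalized,
monomialized initial state of [CoP1] Prop. 8.1 for a `K`-finite tracked element `F` (a multiple
of `ι(h)`, `h = g f₁ ⋯ f_r ∈ A`), it RUNS the loops `E = F`, `♯E ≤ r` along the extension `v̂` —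
whose rank and rational rank may exceed those of `v` — with the archimedean comparabilities and
rational-rank relations supplied on the ring of `K`-finite-denominator fractions
(`ArithmeticalThreefoldsCompletionValues{Iso,Dep}.lean`), and concludes (LU) for `A` at `v` by
(511), (512) and the end of the proof (`exists_adjoin_isRegularLocalRing_of_lemma47Frame`), the
shape elements of (512) being read off the denominators of the model ((510): they divide a power
of `F`, which ends as a unit times a monomial).

* `exists_shape_of_dvd_pow_frame` — in a frame model: `b = D Q y` with `D ∣ F^N`, `Q` a unit and
  `F = w′ ∏_{i<r′} x′ᵢ^{eᵢ}` gives `b = ε (∏_{i<r′} x′ᵢ^{mᵢ}) y`;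
* `exists_adjoin_isRegularLocalRing_of_principalizedFrame` — (LU) for `A` at `v` from the
  principalized initial state over `S₀` (the hypotheses of
  `head_conclusion_of_principalized_within_F`, with `harchC`/`hdep` DERIVED from the `K`-finite
  denominators), the rank data of `v` on `K`, and the denominators of `S₀` over `Â`.

What is NOT here: the model `S₀` with its denominators (journal Prop. 4.6 / Thm. 1.1 (ii) for
`Spec Â`, or a local uniformization of `v̂` inside `Â_{P∞}`) and the pre-stage (principalization
of `𝔪_{S₀}`, monomialization of `F`, [CoP1] Prop. 4.1 / Cor. 4.6).

## Sources

* V. Cossart, O. Piltant, J. Algebra 529 (2019) 268–535 = arXiv:1412.0868, proof of Prop. 4.8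
  with Lemma 4.7 and (510)–(512) (arXiv v1: Prop. 4.6, pp. 52–53). [CossartPiltant2019]
* V. Cossart, O. Piltant, J. Algebra 320 (2008) 1051–1082: Prop. 8.1 (HAL hal-00139124,
  pp. 22–23). [CossartPiltant2008]
-/

noncomputable section

namespace Literature.AlgebraicGeometry.Resolution

universe u

open IsLocalRing _root_.Polynomial Function

/-! ## The shape elements in the frame -/

section ShapeFrame

variable {S : Type u} [CommRing S] [IsDomain S] [IsLocalRing S] {E : Type u} [Field E]
  [Algebra S E] [Algebra.IsAlgebraic S E]
  (hSuc : IsUniversallyCatenaryRing S) (hinj : Function.Injective (algebraMap S E))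
  (OE : ValuationSubring E) (hSO : ∀ s : S, algebraMap S E s ∈ OE)
  (hdom : ∀ s ∈ maximalIdeal S, OE.valuation (algebraMap S E s) < 1)
  (hres : ∀ y : OE, ∃ q : S[X], (∃ i, q.coeff i ∉ maximalIdeal S) ∧
    OE.valuation (q.eval₂ (algebraMap S E) y) < 1)
  (hSdim : ringKrullDim S = (3 : ℕ))

include hSuc hinj hSO hdom hres hSdim in
/-- **(510) ⇒ (512) in the frame.** In a regular frame model `R = locAtCentre (S[t]) O_E` of
dimension `3` with regular parameters `x′` and `F = w′ ∏_{i<r′} x′ᵢ^{eᵢ}` (`w′` a unit): if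
`b = D Q y` with `D, Q, y ∈ R`, `D ∣ F^N` in `R` and `v(Q) = 0`, then `b = ε (∏_{i<r′} x′ᵢ^{mᵢ}) y`
for a unit `ε` of `R` (the `x′ᵢ` are prime elements; divisors of a unit times a monomial are
units times monomials). [cite: CossartPiltant2019, proof of Prop. 4.8, (510)–(512) (arXiv v1: Prop. 4.6, p. 53)] -/
theorem exists_shape_of_dvd_pow_frame (t : Set E) (ht : t.Finite)
    (hTO : (Algebra.adjoin S t).toSubring ≤ OE.toSubring)
    (hreg : IsRegularLocalRing (locAtCentre (Algebra.adjoin S t).toSubring OE))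
    (x' : Fin 3 → locAtCentre (Algebra.adjoin S t).toSubring OE)
    (hspan : haveI := isLocalRing_locAtCentre hTO
      Ideal.span (Set.range x') = maximalIdeal _)
    (r' : ℕ) (hr' : r' ≤ 3) (F : E) (w' : (locAtCentre (Algebra.adjoin S t).toSubring OE)ˣ)
    (e : Fin r' → ℕ)
    (hF : F = ((w' : locAtCentre (Algebra.adjoin S t).toSubring OE) : E) *
      ∏ j, ((x' (Fin.castLE hr' j) : locAtCentre (Algebra.adjoin S t).toSubring OE) : E) ^ e j)
    {D c Q y b : E} (hD : D ∈ locAtCentre (Algebra.adjoin S t).toSubring OE)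
    (hc : c ∈ locAtCentre (Algebra.adjoin S t).toSubring OE) {N : ℕ} (hDc : F ^ N = D * c)
    (hQ : Q ∈ locAtCentre (Algebra.adjoin S t).toSubring OE) (hvQ : OE.valuation Q = 1)
    (hy : y ∈ locAtCentre (Algebra.adjoin S t).toSubring OE) (hb : b = D * Q * y) :
    ∃ (ε : (locAtCentre (Algebra.adjoin S t).toSubring OE)ˣ) (m : Fin r' → ℕ),
      b = ((ε : locAtCentre (Algebra.adjoin S t).toSubring OE) : E) *
        (∏ j, ((x' (Fin.castLE hr' j) : locAtCentre (Algebra.adjoin S t).toSubring OE) : E) ^ m j) *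
        y := by
  classical
  haveI := isLocalRing_locAtCentre hTO
  haveI := hreg
  haveI : IsDomain (locAtCentre (Algebra.adjoin S t).toSubring OE) := inferInstance
  -- the parameters are prime elements
  have hdimR : ringKrullDim (locAtCentre (Algebra.adjoin S t).toSubring OE) = (3 : ℕ) := by
    haveI : Algebra.FiniteType S (Algebra.adjoin S t) := by
      rw [← ht.coe_toFinset]
      exact (Subalgebra.fg_iff_finiteType _).mp (Subalgebra.fg_adjoin_finset _)
    rw [ringKrullDim_locAtCentre_eq_of_frame hSuc hinj OE hSO hdom hres (Algebra.adjoin S t) hTO,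
      hSdim]
  have hd : (maximalIdeal (locAtCentre (Algebra.adjoin S t).toSubring OE)).spanFinrank = 3 := by
    have h := IsRegularLocalRing.spanFinrank_maximalIdeal
      (R := locAtCentre (Algebra.adjoin S t).toSubring OE)
    rw [hdimR] at h
    exact_mod_cast h
  have hx0 : ∀ j, (x' j : E) ≠ 0 := fun j =>
    coe_rsop_ne_zero_of_frame hSuc hinj OE hSO hdom hres hSdim t ht hTO hreg x' hspan j
  have hprime : ∀ c, Prime (x' c) := by
    intro c
    have h := isPrime_span_image hd x' hspan {c}
    rw [Finset.coe_singleton, Set.image_singleton] at h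
    refine (Ideal.span_singleton_prime ?_).mp h
    intro h0
    exact hx0 c (by rw [h0]; rfl)
  -- everything in the local ring `R`
  set u : Fin r' → locAtCentre (Algebra.adjoin S t).toSubring OE := fun j => x' (Fin.castLE hr' j)
  have hu : ∀ j, Prime (u j) := fun j => hprime _
  set FR : locAtCentre (Algebra.adjoin S t).toSubring OE :=
    (w' : locAtCentre (Algebra.adjoin S t).toSubring OE) * ∏ j, u j ^ e j with hFR
  have hFRval : (FR : E) = F := by
    rw [hF, hFR]
    simp only [u, Subring.coe_mul, SubmonoidClass.coe_finsetProd, SubmonoidClass.coe_pow]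
  have hdvd : (⟨D, hD⟩ : locAtCentre (Algebra.adjoin S t).toSubring OE) ∣ FR ^ N := by
    refine ⟨⟨c, hc⟩, Subtype.ext ?_⟩
    simp only [SubmonoidClass.coe_pow, Subring.coe_mul, hFRval]
    exact hDc
  have hQunit : IsUnit (⟨Q, hQ⟩ : locAtCentre (Algebra.adjoin S t).toSubring OE) := by
    by_contra hnu
    have := (not_isUnit_locAtCentre_iff hTO ⟨Q, hQ⟩).mp hnu
    rw [hvQ] at this
    exact lt_irrefl _ this
  obtain ⟨ε, m, hεm⟩ := exists_units_mul_prod_pow_mul_of_dvd_pow_monomial u hu FR w' e rfl hdvd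
    (b := (⟨D, hD⟩ : locAtCentre (Algebra.adjoin S t).toSubring OE) * hQunit.unit * ⟨y, hy⟩)
    (y := ⟨y, hy⟩) hQunit.unit rfl
  refine ⟨ε, m, ?_⟩
  have h := congrArg (fun z : locAtCentre (Algebra.adjoin S t).toSubring OE => (z : E)) hεm
  simp only [Subring.coe_mul, SubmonoidClass.coe_finsetProd, SubmonoidClass.coe_pow,
    IsUnit.unit_spec, u] at h
  rw [hb]
  exact h

end ShapeFrame

/-! ## Running Lemma 4.7 along `v̂` -/

section Run

variable {A : Type u} [CommRing A] [IsDomain A] [IsLocalRing A] [IsNoetherianRing A]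
  {K : Type u} [Field K] [Algebra A K] [IsFractionRing A K]

set_option maxHeartbeats 1600000 in
/-- **Cossart–Piltant 2019, Prop. 4.8: Lemma 4.7 run along `v̂`, then (511)–(512) and the end of
the proof.** Data: `A` a Noetherian local domain essentially of finite type over a field `k`,
fraction field `K`, `O` a rank-one valuation ring of `K` containing and dominating `A`, whose value
group has rational rank `≤ r` (relations among any `> r` values, `exists_rank_data`); the formal
branch `K̂₁` (`Â → K̂₁` with kernel a minimal prime, `K̂₁ = QF(Â/P̂₁)`), `ι : K → K̂₁`, `O' ⊇ Â`
a valuation ring of `K̂₁` with residue field algebraic over that of `Â` and `O' ∩ K = O`; a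
regular frame base `S₀` — a local domain, `Â`-algebra essentially of finite type, inside `K̂₁`,
contained in and dominated by `O'`, with residues of `O'` algebraic over it, of dimension `3` and
universally catenary — whose image `A_e ⊆ K̂₁` has the denominator property of (510) relative to
the tracked element `F` (every `y ∈ A_e` satisfies `b = D Q y`, `b ∈ Â`, `D ∣ F^N`, `Q` a unit
of the initial model); a subring `C ⊇ A_e ∋ F⁻¹` of `K`-finite-denominator fractions and `F`
`K`-finite; and the principalized, monomialized initial state of [CoP1] Prop. 8.1 over `S₀`
(regular model `R_t`, `F = u x^α`, `Fⁿ t ⊆ A_e`, `h = w x^β` generating `𝔪_{A_e} R_t` with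
`∅ ≠ supp β ⊆ supp α`, `f₁, …, f_r ∈ K` dividing `F` in `R_t` with multiplicatively independent
`v`-values). Conclusion: some finitely generated `A[s] ⊆ O` is regular at the centre of `O` —
(LU) for `A` at `v`. Proof: the comparabilities and relations along `v̂` on `locAtCentre C O'`
(`exists_pow_valuation_le_of_mem_locAtCentre_of_finite_denominators`,
`exists_rel_valuation_of_mem_locAtCentre_of_le`), the loops
(`head_conclusion_of_principalized_within_F`), the shape elements from the denominators
(`exists_shape_of_dvd_pow_frame`), and `exists_adjoin_isRegularLocalRing_of_lemma47Frame`.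
[cite: CossartPiltant2019, proof of Prop. 4.8 with Lemma 4.7 and (510)–(512) (arXiv v1: Prop. 4.6, pp. 52–53)]
[cite: CossartPiltant2008, proof of Prop. 8.1 (HAL pp. 22–23)] -/
theorem exists_adjoin_isRegularLocalRing_of_principalizedFrame
    (k : Type u) [Field k] [Algebra k A] [Algebra.EssFiniteType k A]
    (O : ValuationSubring K) (hrk : Nonempty O.valuation.RankOne)
    (hAO : ∀ x : A, algebraMap A K x ∈ O)
    (hdomA : ∀ x ∈ maximalIdeal A, O.valuation (algebraMap A K x) < 1)
    (r : ℕ) (hr0 : 0 < r)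
    (hdepK : ∀ (d : ℕ) (I : Finset (Fin d)) (a : Fin d → K), r < I.card → (∀ k, a k ≠ 0) →
      ∃ c : Fin d → ℤ, (∀ k, k ∉ I → c k = 0) ∧ c ≠ 0 ∧
        ∏ k, O.valuation (a k) ^ (c k).toNat = ∏ k, O.valuation (a k) ^ (-c k).toNat)
    {K₁ : Type u} [Field K₁] [Algebra (AdicCompletion (maximalIdeal A) A) K₁]
    (hP₁ : RingHom.ker (algebraMap (AdicCompletion (maximalIdeal A) A) K₁) ∈
      minimalPrimes (AdicCompletion (maximalIdeal A) A))
    (hK₁ : ∀ z : K₁, ∃ a b : AdicCompletion (maximalIdeal A) A,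
      z = algebraMap _ K₁ a / algebraMap _ K₁ b)
    (ι : K →+* K₁) (hι : ι.comp (algebraMap A K) =
      (algebraMap (AdicCompletion (maximalIdeal A) A) K₁).comp
        (algebraMap A (AdicCompletion (maximalIdeal A) A)))
    (O' : ValuationSubring K₁)
    (hRO' : ∀ x : AdicCompletion (maximalIdeal A) A, algebraMap _ K₁ x ∈ O')
    (halgO' : ∀ y : O', ∃ p : Polynomial (AdicCompletion (maximalIdeal A) A),
      (∃ i, p.coeff i ∉ (maximalIdeal A).map (algebraMap A (AdicCompletion (maximalIdeal A) A))) ∧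
      O'.valuation (p.eval₂ (algebraMap (AdicCompletion (maximalIdeal A) A) K₁) y) < 1)
    (hO : O'.comap ι = O)
    -- the frame base
    {S₀ : Type u} [CommRing S₀] [IsDomain S₀] [IsLocalRing S₀]
    [Algebra (AdicCompletion (maximalIdeal A) A) S₀]
    [Algebra.EssFiniteType (AdicCompletion (maximalIdeal A) A) S₀] [Algebra S₀ K₁]
    [IsScalarTower (AdicCompletion (maximalIdeal A) A) S₀ K₁] [Algebra.IsAlgebraic S₀ K₁]
    (hSuc : IsUniversallyCatenaryRing S₀) (hinj : Function.Injective (algebraMap S₀ K₁))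
    (hS₀O : ∀ s : S₀, algebraMap S₀ K₁ s ∈ O')
    (hdomS₀ : ∀ s ∈ maximalIdeal S₀, O'.valuation (algebraMap S₀ K₁ s) < 1)
    (hres : ∀ y : O', ∃ q : S₀[X], (∃ i, q.coeff i ∉ maximalIdeal S₀) ∧
      O'.valuation (q.eval₂ (algebraMap S₀ K₁) y) < 1)
    (hSdim : ringKrullDim S₀ = (3 : ℕ))
    -- its image `A_e` and the denominators of (510)
    (Ae : Subring K₁) (hSA : ∀ s : S₀, algebraMap S₀ K₁ s ∈ Ae)
    (hAS : ∀ y ∈ Ae, ∃ s : S₀, algebraMap S₀ K₁ s = y)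
    -- the initial state
    (t : Set K₁) (ht : t.Finite) (hTO : (Algebra.adjoin S₀ t).toSubring ≤ O'.toSubring)
    (hreg : IsRegularLocalRing (locAtCentre (Algebra.adjoin S₀ t).toSubring O'))
    (x : Fin 3 → locAtCentre (Algebra.adjoin S₀ t).toSubring O')
    (hx : haveI := isLocalRing_locAtCentre hTO
      Ideal.span (Set.range x) = maximalIdeal _)
    (F u : K₁) (hFA : F ∈ Ae) (huR : u ∈ locAtCentre (Algebra.adjoin S₀ t).toSubring O')
    (hvu : O'.valuation u = 1) (α : Fin 3 → ℕ) (hF : F = u * ∏ c, (x c : K₁) ^ α c)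
    (hTR : ∀ z ∈ t, ∃ n : ℕ, F ^ n * z ∈ Ae)
    (hFfin : ∃ b : K, b ≠ 0 ∧ O'.valuation (ι b) ≤ O'.valuation F)
    (hden : ∀ y ∈ Ae, ∃ (b : AdicCompletion (maximalIdeal A) A) (D Q : K₁),
      D ∈ locAtCentre (Algebra.adjoin S₀ t).toSubring O' ∧
      (∃ (N : ℕ) (c : K₁), c ∈ locAtCentre (Algebra.adjoin S₀ t).toSubring O' ∧ F ^ N = D * c) ∧
      Q ∈ locAtCentre (Algebra.adjoin S₀ t).toSubring O' ∧ O'.valuation Q = 1 ∧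
      algebraMap _ K₁ b = D * Q * y)
    (C : Subring K₁) (hAC : Ae ≤ C) (hFC : F⁻¹ ∈ C)
    (hC : ∀ y ∈ C, ∃ x e : AdicCompletion (maximalIdeal A) A,
      (∃ b : K, b ≠ 0 ∧ O'.valuation (ι b) ≤ O'.valuation (algebraMap _ K₁ e)) ∧
        y * algebraMap _ K₁ e = algebraMap _ K₁ x)
    (h w : K₁) (hwR : w ∈ locAtCentre (Algebra.adjoin S₀ t).toSubring O')
    (hvw : O'.valuation w = 1) (β : Fin 3 → ℕ) (hh : h = w * ∏ c, (x c : K₁) ^ β c)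
    (hβα : ∀ c, 0 < β c → 0 < α c) (hβne : ∃ c, 0 < β c)
    (hdomAe : ∀ y ∈ Ae, O'.valuation y < 1 →
      ∃ c ∈ locAtCentre (Algebra.adjoin S₀ t).toSubring O', y = h * c)
    (f : Fin r → K) (hfR : ∀ i, ι (f i) ∈ locAtCentre (Algebra.adjoin S₀ t).toSubring O')
    (hfdvd : ∀ i, ∃ c ∈ locAtCentre (Algebra.adjoin S₀ t).toSubring O', F = ι (f i) * c)
    (hind : ∀ p m : Fin r → ℕ, ∏ i, O.valuation (f i) ^ p i = ∏ i, O.valuation (f i) ^ m i →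
      p = m) :
    ∃ (s : Finset K) (hs : (Algebra.adjoin A (s : Set K)).toSubring ≤ O.toSubring),
      IsRegularLocalRing (Localization.AtPrime
        (Ideal.comap (Subring.inclusion hs) (maximalIdeal O))) := by
  classical
  have hιA : ∀ a : A, algebraMap (AdicCompletion (maximalIdeal A) A) K₁
      (algebraMap A (AdicCompletion (maximalIdeal A) A) a) = ι (algebraMap A K a) := fun a => by
    have := RingHom.congr_fun hι a
    simpa only [RingHom.comp_apply] using this.symm
  have hequiv : O.valuation.IsEquiv (O'.valuation.comap ι) := by
    rw [Valuation.isEquiv_iff_valuationSubring, ValuationSubring.valuationSubring_valuation]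
    ext z
    rw [Valuation.mem_valuationSubring_iff, Valuation.comap_apply,
      ValuationSubring.valuation_le_one_iff, ← ValuationSubring.mem_comap, hO]
  -- the suppliers along `v̂`
  have harchC : ∀ y ∈ locAtCentre C O', O'.valuation y < 1 →
      ∃ n : ℕ, O'.valuation y ^ n ≤ O'.valuation F := by
    intro y hy hvy
    obtain ⟨b, hb, hbF⟩ := hFfin
    obtain ⟨n, hn⟩ := exists_pow_valuation_le_of_mem_locAtCentre_of_finite_denominators O hrk hAO
      hdomA ι hι O' hRO' hO C hC hy hvy b hb
    exact ⟨n, hn.trans hbF⟩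
  have hdep : ∀ (I : Finset (Fin 3)) (y : Fin 3 → K₁), r < I.card → (∀ k, y k ≠ 0) →
      (∀ k ∈ I, y k ∈ locAtCentre C O' ∧ O'.valuation F ≤ O'.valuation (y k)) →
      ∃ c : Fin 3 → ℤ, (∀ k, k ∉ I → c k = 0) ∧ c ≠ 0 ∧
        ∏ k, O'.valuation (y k) ^ (c k).toNat = ∏ k, O'.valuation (y k) ^ (-c k).toNat :=
    fun I y hI hy0 hyC => exists_rel_valuation_of_mem_locAtCentre_of_le O hrk hAO hdomA ι hι O'
      hRO' hO C hC hFfin r hdepK I y hI hy0 hyC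
  -- the `fᵢ` in `K̂₁`
  have hfM : ∀ i, ι (f i) ∈ ι.fieldRange := fun i => RingHom.mem_fieldRange.mpr ⟨f i, rfl⟩
  have hind' : ∀ p m : Fin r → ℕ, ∏ i, O'.valuation (ι (f i)) ^ p i =
      ∏ i, O'.valuation (ι (f i)) ^ m i → p = m := by
    intro p m hpm
    refine hind p m ?_
    have h1 : O'.valuation (ι (∏ i, f i ^ p i)) = O'.valuation (ι (∏ i, f i ^ m i)) := by
      rw [map_prod, map_prod, map_prod, map_prod]
      simp_rw [map_pow]
      exact hpm
    have h2 := (hequiv.eq_iff).mpr (by simpa only [Valuation.comap_apply] using h1)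
    rw [map_prod, map_prod] at h2
    simp_rw [map_pow] at h2
    exact h2
  -- the loops `E = F`, `♯E ≤ r` and the extraction
  have hSK : ∀ s : S₀, algebraMap S₀ K₁ s ∈ (⊤ : Subfield K₁) := fun _ => Subfield.mem_top _
  obtain ⟨t'', -, hT''O, hB₀'', hreg'', r', hr', hr0', x', hx'0, hspan', hq3, ⟨f', γ', a', hf'M,
      hf'a, hdet⟩, ⟨w', e, hFmono⟩, hTR''⟩ :=
    head_conclusion_of_principalized_within_F hSuc hinj O' hS₀O hdomS₀ hres hSdim Ae hSA ι.fieldRange ⊤ hSK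
      (Algebra.adjoin S₀ t) t ht (fun _ _ => Subfield.mem_top _) hTO le_rfl hreg x hx F u hFA huR
      hvu α hF hTR C hAC hFC harchC h w hwR hvw β hh hβα hβne hdomAe r hr0 hdep (fun i => ι (f i))
      hfM hfR hfdvd hind'
  have hsub : locAtCentre (Algebra.adjoin S₀ t).toSubring O' ≤
      locAtCentre (Algebra.adjoin S₀ (t'' : Set K₁)).toSubring O' :=
    locAtCentre_mono O' (fun y hy => hB₀'' hy)
  -- `F` and the image of `S₀` lie in the final local ring
  have hAeR : ∀ y ∈ Ae, y ∈ locAtCentre (Algebra.adjoin S₀ (t'' : Set K₁)).toSubring O' := by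
    intro y hy
    obtain ⟨s, rfl⟩ := hAS y hy
    exact le_locAtCentre _ _ ((Algebra.adjoin S₀ (t'' : Set K₁)).algebraMap_mem s)
  -- preimages in `K` of the `f'ᵢ`
  have hf'K : ∀ i, ∃ g : K, ι g = f' i := fun i => RingHom.mem_fieldRange.mp (hf'M i)
  choose fK hfK using hf'K
  refine exists_adjoin_isRegularLocalRing_of_lemma47Frame k O hdomA hP₁ hK₁ ι hι O' halgO' hO
    t'' hT''O hreg'' x' hx'0 hspan' r' hr' hr0' ?_ fK γ' a' (fun i => by rw [hfK i]; exact hf'a i)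
    hdet ?_
  · -- `m_A` lands in `(x'₁ ⋯ x'_{r'})`
    intro a y ha hy
    refine hq3 y ?_ ?_
    · rw [hy, ← hιA, IsScalarTower.algebraMap_apply (AdicCompletion (maximalIdeal A) A) S₀ K₁]
      exact hSA _
    · rw [hy]
      have h1 : O.valuation (algebraMap A K a) < O.valuation 1 := by
        rw [map_one]; exact hdomA a ha
      have h2 := (hequiv.lt_iff_lt).mp h1
      simpa only [Valuation.comap_apply, map_one] using h2
  · -- the shape elements of the complementary parameters, from the denominators ((510))
    intro c _hc
    -- level 1: the generators `t''` have `F`-power denominators relative to `A_e = S₀`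
    have hden₁ : ∀ z ∈ (t'' : Set K₁), ∃ a : S₀, algebraMap S₀ K₁ a ∈ Submonoid.powers F ∧
        ∃ b : S₀, algebraMap S₀ K₁ a * z = algebraMap S₀ K₁ b := by
      intro z hz
      obtain ⟨n, hn⟩ := hTR'' z hz
      obtain ⟨sF, hsF⟩ := hAS F hFA
      obtain ⟨b, hb⟩ := hAS _ hn
      exact ⟨sF ^ n, by rw [map_pow, hsF]; exact ⟨n, rfl⟩, b, by rw [map_pow, hsF, hb]⟩
    obtain ⟨a₁, Q₁, ha₁, hQ₁, hvQ₁, b₁, hb₁⟩ :=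
      exists_mul_mul_mem_range_of_mem_locAtCentre_of_denominators O' (t'' : Set K₁)
        (Submonoid.powers F) hden₁ (x' c).2
    obtain ⟨n₁, hn₁⟩ := (Submonoid.mem_powers_iff _ _).mp ha₁
    -- level 2: the denominators of `A_e` over `Â`
    obtain ⟨b, D, Q, hD, ⟨N, cc, hcc, hDc⟩, hQ, hvQ, hb⟩ := hden _ (hSA b₁)
    have hDF : F ^ (N + n₁) = (D * F ^ n₁) * cc := by rw [pow_add, hDc]; ring
    have hFR : F ∈ locAtCentre (Algebra.adjoin S₀ (t'' : Set K₁)).toSubring O' := hAeR F hFA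
    obtain ⟨ε, m, hεm⟩ := exists_shape_of_dvd_pow_frame hSuc hinj O' hS₀O hdomS₀ hres hSdim
      (t'' : Set K₁) t''.finite_toSet hT''O hreg'' x' hspan' r' hr' F w' e hFmono
      (D := D * F ^ n₁) (c := cc) (Q := Q * Q₁) (y := ((x' c : locAtCentre
        (Algebra.adjoin S₀ (t'' : Set K₁)).toSubring O') : K₁))
      (b := algebraMap (AdicCompletion (maximalIdeal A) A) K₁ b)
      (Subring.mul_mem _ (hsub hD) (Subring.pow_mem _ hFR _)) (hsub hcc) hDF
      (Subring.mul_mem _ (hsub hQ) (le_locAtCentre _ _ hQ₁))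
      (by rw [map_mul, hvQ, hvQ₁, one_mul]) (x' c).2
      (by rw [hb, ← hb₁, ← hn₁]; ring)
    exact ⟨b, ε, m, hεm⟩

end Run

end Literature.AlgebraicGeometry.Resolution

end
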